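import Summits.BirchSwinnertonDyer.BirchSwinnertonDyer.Theses.KatoDescentPotSupersingular
import Summits.BirchSwinnertonDyer.BirchSwinnertonDyer.Theorems.PotSupersingularWildLowerClassTransport
import Summits.BirchSwinnertonDyer.BirchSwinnertonDyer.Theorems.KatoDescentPotSupersingularWildLowerSubgroupWitness
import HarnessLib

/-!
# Route `KatoDescentPotSupersingular` (rung K9, B5: O6 = wild `p = 3`): the registered BC5 rung
# `stub_intr_mod3_rung` of the open core 19663 `WildLowerIntrinsicNonCM` — kernel verdict
# (a `--supports 19663 --as helper` file; seat bsd-potss-k9-c2, generation 6)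

The BC3 birth skeleton of the child crux 19663 (planner g14, 2026-08-26T13:16Z, registered with
`ledger skeleton check --crux`) keeps ONE plan-only BC5 rung, `Sig.stub_intr_mod3_rung`: on a rank-`0` wild
row of a NON-CM curve `W` whose whole isogeny class is INTRINSIC (every globally minimal `W' ∼ W` has
`ord₃ #Ш_an(W') > 0`), `1 ≤ ord₃ #Ш_an(W) ⟹ 1 ≤ ord₃ #Ш(W)`. TARGET row R111 names it the first prover target
on K9. This file settles what the rung IS, in kernel form, with the rung's signature spelled VERBATIM (the
skeleton lives outside the tree, so its `Sig.…` abbreviations are unfolded here):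

* §1 `intrMod3Rung_of_wildLowerIntrinsicNonCM` — the open core gives the rung with NO input (the rational
  `#Ш_an` is unique): the rung is the core truncated at `1`;
* §2 (the new content) `padicValRat_sub_le_padicValNat_shaOrder_of_isIsogenous` — over Cassels `hC`, GZK `hG`,
  modularity `hM`, for globally minimal `W ∼ W'` of analytic rank `0` with rational `#Ш_an(W) = q`,
  `#Ш_an(W') = q'`: **`ord_p q − ord_p q' ≤ ord_p #Ш(W)`** at EVERY prime `p` (Cassels' defect identity
  `ord_p q − ord_p #Ш(W) = ord_p q' − ord_p #Ш(W')` and `ord_p #Ш(W') ≥ 0`). Hence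
  `one_le_padicValNat_shaOrder_of_isIsogenous_lt`: **the rung HOLDS OUTRIGHT (modulo the three held inputs
  19619–19621) at every class member that is not `Ш_an`-minimal** — if some globally minimal `W' ∼ W` has
  `ord₃ #Ш_an(W') < ord₃ #Ш_an(W)` then `3 ∣ #Ш(W)`, with no Euler system and no certificate; and
  `one_le_padicValNat_shaOrder_of_isIsogenous_of_le`: the rung at a member transports UP the class (to every
  member with `ord₃ #Ш_an` at least as large) but not down;
* §3 `intrMod3Rung_of_minimalMemberRung` — consequently the rung's body follows from the three held inputs and
  the rung at the `Ш_an`-MINIMAL globally minimal member `W₀` of each intrinsic non-CM wild class ONLY: the open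
  content of the rung sits at exactly the same curves as the open content of the core
  (`wildLowerIntrinsicNonCM_iff_minimalMember`, p447017), namely `3 ∣ #Ш(W₀)`, the first case of
  `3 ^ ord₃ #Ш_an(W₀) ∣ #Ш(W₀)`;
* §4 `missingLowerBoundAt_intr_shallow_of_intrMod3Rung` — with the Cassels–Tate input (19420) and GZK the rung
  gives the CORE on every intrinsic row with `ord₃ #Ш_an ≤ 2` (census of record, k9-c2 g2–g4: 1 759 of the
  1 770 intrinsic classes below conductor `5·10⁵` at their minimal member) — so the rung is not a weakening
  of the core in substance (generation 3's `missingLowerBoundAt_shallow_of_mod3Rung`, re-threaded through the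
  child's two extra hypotheses);
* §5 `shaFinite_of_intrMod3Rung` — STRENGTH (tribunal/BC5 record): the bare rung already contains the
  finiteness of `Ш(W)` on its rows (`1 ≤ ord₃ (Nat.card Ш)` forces `Nat.card Ш ≠ 0`), i.e. it cannot be landed
  in the tree's present state without Gross–Zagier–Kolyvagin in the kernel — as typed it is not closable even
  in principle by a published-inputs argument unless re-typed `PublishedInputRankEqAnalyticRankW → … → rung`.

VERDICT for R111 (K9 line): `stub-blocked: stub_intr_mod3_rung` — modulo the held inputs it is EQUIVALENT on
the shallow classes to the open core itself (Kato's Conj. 12.10 lower inclusion at the additive prime `3` on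
the intrinsic non-CM O6 classes; no `p`-adic `L`-function / main conjecture in print there), its only free
rows are the non-minimal members (§2), and as typed it embeds GZK (§5). A BC5 rung that IS a theorem today in
the crux's currency: §2's non-minimal-member divisibility, or the unit-member transport
`missingLowerBoundAt_wild_of_isIsogenous_unit` (the route's named T3 witness). The four `_of` stubs of the
skeleton (`stub_intr_irred_fwLocus`, `stub_intr_kimRows`, `stub_intr_irred_residual`, `stub_intr_red`) are
respectively: conditional on ONE pre-publication claim (arXiv:2107.13726 Thm 5.1; kernel road
`lower_irred_fwLocus_of_fwClaim_of_readings`, p417825), per-pair certificates only (kernel road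
`lower_irred_towerSurj_of_kimAtThree_of_kuriharaUnits`, p418866; class-wide = Kurihara's conjecture), and the
open problem twice (KMC₃; kernel road `wildLowerHalfRankZero_of_kmcThree_torsionFree`, p417825). Nothing is
booked; 19663 and 19195 stay OPEN; BSD is not proved by any of this.

References: [Cassels1965ArithmeticVIII]; [MilneADT2006] Thm. I.7.3; [Miller2011LMS] §1, Def. 1.1;
[SilvermanAEC2009] Thm. X.4.14; [Kolyvagin1990]; [GrossZagier1986]; [Kato2004Asterisque] Conj. 12.10 (p. 224).
-/

set_option autoImplicit false
-- sibling precedent (`KatoDescentPotSupersingularAssembly.lean`): the directory name repeats the summit name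
set_option linter.dupNamespace false

noncomputable section

open scoped Classical

namespace Summit.BirchSwinnertonDyer.BirchSwinnertonDyer.Theorems

open WeierstrassCurve Literature.NumberTheory.EllipticCurves
  Literature.NumberTheory.EllipticCurves.Rank1Residual
  Literature.NumberTheory.EllipticCurves.Rank1Residual.Typed
  Summit.BirchSwinnertonDyer.Rank1Residual.Additive
  Summit.BirchSwinnertonDyer.Rank1Residual
  Summit.BirchSwinnertonDyer.BirchSwinnertonDyer.Theses.KatoDescentPotSupersingular

/-! ## §1 The open core gives the rung (no input) -/

/-- **The open core 19663 gives the registered rung `stub_intr_mod3_rung`** (body spelled verbatim), with no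
input: `MissingLowerBoundAt W 3` reads `ord₃ q ≤ ord₃ #Ш(W)` for THE rational `q = #Ш_an(W)` (the cast
`ℚ → ℂ` is injective), so `1 ≤ ord₃ q` gives `1 ≤ ord₃ #Ш(W)`. The rung is the core truncated at `1`.
Bookkeeping. [cite: Miller2011LMS, Def. 1.1] -/
theorem intrMod3Rung_of_wildLowerIntrinsicNonCM (h : WildLowerIntrinsicNonCM) :
    ∀ (W : WeierstrassCurve ℚ) [W.IsElliptic] [W.IsGloballyMinimal] [Fact (3 : ℕ).Prime],
      W.analyticRank = 0 → ClassO6 W 3 → ¬ W.HasCM →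
      (∀ (W' : WeierstrassCurve ℚ) [W'.IsElliptic] [W'.IsGloballyMinimal], IsIsogenous W W' →
        ∀ q' : ℚ, shaAn W' = (q' : ℂ) → 0 < padicValRat 3 q') →
      (∃ q : ℚ, shaAn W = (q : ℂ) ∧ 1 ≤ padicValRat 3 q) → 1 ≤ padicValNat 3 W.shaOrder := by
  intro W _ _ _ hr hO6 hcm hI hq1
  obtain ⟨q, hq, h1⟩ := hq1
  obtain ⟨r, hr', hle⟩ := h W hr hO6 hcm hI
  have hrq : r = q := by exact_mod_cast hr'.symm.trans hq
  subst hrq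
  have h1' : (1 : ℤ) ≤ (padicValNat 3 W.shaOrder : ℤ) := h1.trans hle
  exact_mod_cast h1'

/-! ## §2 Cassels' defect identity read as a lower bound: the rung at non-minimal members -/

section Gap

variable (W : WeierstrassCurve ℚ) [W.IsElliptic] [W.IsGloballyMinimal] (p : ℕ) [Fact p.Prime]
  (W' : WeierstrassCurve ℚ) [W'.IsElliptic] [W'.IsGloballyMinimal]

/-- **The `Ш_an`-gap along a class bounds `#Ш` below.** For globally minimal `ℚ`-isogenous `W ∼ W'` of
analytic rank `0` with rational `#Ш_an(W) = q` and `#Ш_an(W') = q'`: `ord_p q − ord_p q' ≤ ord_p #Ш(W)` at every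
prime `p`. Proof: Cassels' defect identity `ord_p q − ord_p #Ш(W) = ord_p q' − ord_p #Ш(W')`
(`exists_shaAn_eq_padicValRat_ge_of_isIsogenous`, p444599, over Cassels `hC`, GZK `hG` — finiteness of `Ш(W)` —
and modularity `hM`) and `ord_p #Ш(W') ≥ 0`. With `ord_p q' ≤ 0` this is the unit-member transport
(`missingLowerBoundAt_rankZero_of_isIsogenous_unitMember`); in general it is a divisibility
`p ^ (ord_p #Ш_an(W) − ord_p #Ш_an(W')) ∣ #Ш(W)` that needs no Euler system and no certificate.
[cite: Cassels1965ArithmeticVIII] [cite: MilneADT2006, Thm. I.7.3] [cite: Miller2011LMS, §1 and Def. 1.1] -/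
theorem padicValRat_sub_le_padicValNat_shaOrder_of_isIsogenous (hC : bsdRHS_eq_of_isIsogenous)
    (hG : rank_eq_analyticRank_of_analyticRank_le_one) (hM : hasEntireLFunction_rat)
    (hr : W.analyticRank = 0) (hiso : IsIsogenous W W') {q q' : ℚ} (hq : shaAn W = (q : ℂ))
    (hq' : shaAn W' = (q' : ℂ)) :
    padicValRat p q - padicValRat p q' ≤ (padicValNat p W.shaOrder : ℤ) := by
  obtain ⟨r', hr', hδ⟩ := exists_shaAn_eq_padicValRat_ge_of_isIsogenous hC hG hM W p hr W' hiso hq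
  have hrq : r' = q' := by exact_mod_cast hr'.symm.trans hq'
  subst hrq
  have h0 : (0 : ℤ) ≤ (padicValNat p W'.shaOrder : ℤ) := by exact_mod_cast Nat.zero_le _
  omega

/-- **The rung holds outright at every member that is not `Ш_an`-minimal.** For globally minimal
`ℚ`-isogenous `W ∼ W'` of analytic rank `0` with rational `#Ш_an(W) = q`, `#Ш_an(W') = q'` and
`ord_p q' < ord_p q`: `1 ≤ ord_p #Ш(W)`, i.e. `p ∣ #Ш(W)` — over Cassels `hC`, GZK `hG`, modularity `hM` only.
So on an intrinsic class the registered rung is FREE at every member whose `ord₃ #Ш_an` exceeds the class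
minimum; its open content sits at the `Ш_an`-minimal members. [cite: Cassels1965ArithmeticVIII]
[cite: MilneADT2006, Thm. I.7.3] [cite: Miller2011LMS, §1 and Def. 1.1] -/
theorem one_le_padicValNat_shaOrder_of_isIsogenous_lt (hC : bsdRHS_eq_of_isIsogenous)
    (hG : rank_eq_analyticRank_of_analyticRank_le_one) (hM : hasEntireLFunction_rat)
    (hr : W.analyticRank = 0) (hiso : IsIsogenous W W') {q q' : ℚ} (hq : shaAn W = (q : ℂ))
    (hq' : shaAn W' = (q' : ℂ)) (hlt : padicValRat p q' < padicValRat p q) :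
    1 ≤ padicValNat p W.shaOrder := by
  have h := padicValRat_sub_le_padicValNat_shaOrder_of_isIsogenous W p W' hC hG hM hr hiso hq hq'
  have h1 : (1 : ℤ) ≤ (padicValNat p W.shaOrder : ℤ) := by omega
  exact_mod_cast h1

/-- **The rung transports UP a class.** For globally minimal `ℚ`-isogenous `W ∼ W'` of analytic rank `0` with
rational `#Ш_an(W) = q`, `#Ш_an(W') = q'`, `ord_p q ≤ ord_p q'`: if `1 ≤ ord_p #Ш(W)` then `1 ≤ ord_p #Ш(W')`
(Cassels' defect identity: `ord_p #Ш(W') = ord_p #Ш(W) + (ord_p q' − ord_p q)`). So the rung at the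
`Ш_an`-minimal member of a class gives the rung at every member; the converse transport (down the class) is
not available — `ord_p #Ш(W) ≥ 1` at a member with `ord_p q − ord_p q₀ ≥ 1` says nothing at `W₀`.
[cite: Cassels1965ArithmeticVIII] [cite: MilneADT2006, Thm. I.7.3] [cite: Miller2011LMS, §1 and Def. 1.1] -/
theorem one_le_padicValNat_shaOrder_of_isIsogenous_of_le (hC : bsdRHS_eq_of_isIsogenous)
    (hG : rank_eq_analyticRank_of_analyticRank_le_one) (hM : hasEntireLFunction_rat)
    (hr : W.analyticRank = 0) (hiso : IsIsogenous W W') {q q' : ℚ} (hq : shaAn W = (q : ℂ))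
    (hq' : shaAn W' = (q' : ℂ)) (hle : padicValRat p q ≤ padicValRat p q')
    (h1 : 1 ≤ padicValNat p W.shaOrder) : 1 ≤ padicValNat p W'.shaOrder := by
  obtain ⟨r', hr', hδ⟩ := exists_shaAn_eq_padicValRat_ge_of_isIsogenous hC hG hM W p hr W' hiso hq
  have hrq : r' = q' := by exact_mod_cast hr'.symm.trans hq'
  subst hrq
  have h1' : (1 : ℤ) ≤ (padicValNat p W.shaOrder : ℤ) := by exact_mod_cast h1
  have h2 : (1 : ℤ) ≤ (padicValNat p W'.shaOrder : ℤ) := by omega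
  exact_mod_cast h2

end Gap

/-! ## §3 The rung from the held inputs and the rung at the `Ш_an`-minimal member only -/

/-- **The registered rung follows from the three held inputs and the rung at ONE curve per class.** `hmin` =
the rung at every `Ш_an`-MINIMAL globally minimal member `W₀` of the isogeny class of a non-CM wild
analytic-rank-`0` curve `W` with intrinsic class (`ord₃ #Ш_an(W₀) ≤ ord₃ #Ш_an(W')` for every globally
minimal member `W'` with rational `#Ш_an`). Proof: given a row `W` with `1 ≤ ord₃ #Ш_an(W)`, either some
member is strictly cheaper — then §2 (`one_le_padicValNat_shaOrder_of_isIsogenous_lt`) gives `3 ∣ #Ш(W)` from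
Cassels (19619), GZK (19620), modularity (19621) alone — or `W` is itself `Ш_an`-minimal and `hmin` applies at
`W₀ := W`. So the open content of the rung is `3 ∣ #Ш(W₀)` at the minimal member of each intrinsic non-CM
wild class: the first case of the core's `3 ^ ord₃ #Ш_an(W₀) ∣ #Ш(W₀)` (p447017), at the same curves.
Conditional bookkeeping; nothing booked. [cite: Cassels1965ArithmeticVIII] [cite: MilneADT2006, Thm. I.7.3]
[cite: Miller2011LMS, §1 and Def. 1.1] [cite: Kato2004Asterisque, Conj. 12.10 (p. 224)] -/
theorem intrMod3Rung_of_minimalMemberRung (hC : PublishedInputCasselsIsogenyW)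
    (hG : PublishedInputRankEqAnalyticRankW) (hM : PublishedInputEntireLFunctionW)
    (hmin : ∀ (W : WeierstrassCurve ℚ) [W.IsElliptic] [W.IsGloballyMinimal] [Fact (3 : ℕ).Prime],
      W.analyticRank = 0 → ClassO6 W 3 → ¬ W.HasCM →
      (∀ (W' : WeierstrassCurve ℚ) [W'.IsElliptic] [W'.IsGloballyMinimal], IsIsogenous W W' →
        ∀ q' : ℚ, shaAn W' = (q' : ℂ) → 0 < padicValRat 3 q') →
      ∀ (W₀ : WeierstrassCurve ℚ) [W₀.IsElliptic] [W₀.IsGloballyMinimal], IsIsogenous W W₀ →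
      (∀ q₀ : ℚ, shaAn W₀ = (q₀ : ℂ) →
        ∀ (W' : WeierstrassCurve ℚ) [W'.IsElliptic] [W'.IsGloballyMinimal], IsIsogenous W W' →
          ∀ q' : ℚ, shaAn W' = (q' : ℂ) → padicValRat 3 q₀ ≤ padicValRat 3 q') →
      1 ≤ padicValNat 3 W₀.shaOrder) :
    ∀ (W : WeierstrassCurve ℚ) [W.IsElliptic] [W.IsGloballyMinimal] [Fact (3 : ℕ).Prime],
      W.analyticRank = 0 → ClassO6 W 3 → ¬ W.HasCM →
      (∀ (W' : WeierstrassCurve ℚ) [W'.IsElliptic] [W'.IsGloballyMinimal], IsIsogenous W W' →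
        ∀ q' : ℚ, shaAn W' = (q' : ℂ) → 0 < padicValRat 3 q') →
      (∃ q : ℚ, shaAn W = (q : ℂ) ∧ 1 ≤ padicValRat 3 q) → 1 ≤ padicValNat 3 W.shaOrder := by
  intro W _ _ _ hr hO6 hcm hI hq1
  obtain ⟨q, hq, -⟩ := hq1
  by_cases hlt : ∃ (W' : WeierstrassCurve ℚ) (_ : W'.IsElliptic) (_ : W'.IsGloballyMinimal),
      IsIsogenous W W' ∧ ∃ q' : ℚ, shaAn W' = (q' : ℂ) ∧ padicValRat 3 q' < padicValRat 3 q
  · obtain ⟨W', hW', hM', hiso, q', hq', hlt'⟩ := hlt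
    haveI := hW'
    haveI := hM'
    exact one_le_padicValNat_shaOrder_of_isIsogenous_lt W 3 W' hC hG hM hr hiso hq hq' hlt'
  · refine hmin W hr hO6 hcm hI W (isIsogenous_self W) fun q₀ hq₀ W' _ _ hiso' q' hq' ↦ ?_
    have hqq : q₀ = q := by exact_mod_cast hq₀.symm.trans hq
    subst hqq
    by_contra hle
    exact hlt ⟨W', inferInstance, inferInstance, hiso', q', hq', not_le.mp hle⟩

/-! ## §4 With Cassels–Tate the rung is the core on the shallow rows -/

/-- **Rung + Cassels–Tate + GZK ⟹ the CORE on every shallow intrinsic row.** On a non-CM wild analytic-rank-`0`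
row with intrinsic class and `#Ш_an(W) = q`, `ord₃ q ≤ 2`: the rung (hypothesis `hrung`, body verbatim) gives
`3 ∣ #Ш(W)`, the Cassels–Tate rounding (`missingLowerBoundAt_of_pow_dvd_of_casselsTate`, `k = 1`: `#Ш` is a
square) gives `9 ∣ #Ш(W)`, hence `MissingLowerBoundAt W 3`. Census of record: 1 759 of the 1 770 intrinsic
classes below conductor `5·10⁵` are shallow at their minimal member — there the rung IS the core, so it is no
weakening in substance (generation 3's `missingLowerBoundAt_shallow_of_mod3Rung`, re-threaded through the
child's `¬CM`/intrinsic hypotheses). Inputs: Cassels–Tate (19420), GZK (19620). [cite: SilvermanAEC2009, Thm. X.4.14]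
[cite: Miller2011LMS, Def. 1.1] [cite: Kato2004Asterisque, Conj. 12.10 (p. 224)] -/
theorem missingLowerBoundAt_intr_shallow_of_intrMod3Rung (hCT : PublishedInputCasselsTatePairing)
    (hG : PublishedInputRankEqAnalyticRankW)
    (hrung : ∀ (W : WeierstrassCurve ℚ) [W.IsElliptic] [W.IsGloballyMinimal] [Fact (3 : ℕ).Prime],
      W.analyticRank = 0 → ClassO6 W 3 → ¬ W.HasCM →
      (∀ (W' : WeierstrassCurve ℚ) [W'.IsElliptic] [W'.IsGloballyMinimal], IsIsogenous W W' →
        ∀ q' : ℚ, shaAn W' = (q' : ℂ) → 0 < padicValRat 3 q') →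
      (∃ q : ℚ, shaAn W = (q : ℂ) ∧ 1 ≤ padicValRat 3 q) → 1 ≤ padicValNat 3 W.shaOrder)
    (W : WeierstrassCurve ℚ) [W.IsElliptic] [W.IsGloballyMinimal] [Fact (3 : ℕ).Prime]
    (hr : W.analyticRank = 0) (hO6 : ClassO6 W 3) (hcm : ¬ W.HasCM)
    (hI : ∀ (W' : WeierstrassCurve ℚ) [W'.IsElliptic] [W'.IsGloballyMinimal], IsIsogenous W W' →
      ∀ q' : ℚ, shaAn W' = (q' : ℂ) → 0 < padicValRat 3 q')
    {q : ℚ} (hq : shaAn W = (q : ℂ)) (hv : padicValRat 3 q ≤ 2) : MissingLowerBoundAt W 3 := by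
  have hr1 : W.analyticRank ≤ 1 := by rw [hr]; exact zero_le_one
  have h1 : 1 ≤ padicValRat 3 q := hI W (isIsogenous_self W) q hq
  haveI : Finite W.sha := (hG W hr1).2
  have hne : W.shaOrder ≠ 0 := by
    rw [WeierstrassCurve.shaOrder]; exact (Nat.card_pos (α := W.sha)).ne'
  have h3 : 3 ^ 1 ∣ W.shaOrder := (padicValNat_dvd_iff_le hne).mpr (hrung W hr hO6 hcm hI ⟨q, hq, h1⟩)
  exact missingLowerBoundAt_of_pow_dvd_of_casselsTate W 3 hCT hG hr1 hq (k := 1) (by simpa using hv) h3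

/-! ## §5 Strength: the bare rung contains GZK finiteness on its rows -/

/-- **Strength remark (BC5 / tribunal record).** The bare rung `stub_intr_mod3_rung` implies the FINITENESS of
`Ш(W)` at every non-CM wild analytic-rank-`0` curve `W` with intrinsic class and rational `#Ш_an(W) = q`,
`1 ≤ ord₃ q`: the conclusion `1 ≤ ord₃ (Nat.card Ш(W))` forces `Nat.card Ш(W) ≠ 0` (`padicValNat 3 0 = 0`), and
`Nat.card` vanishes on infinite types. So the registered rung cannot be landed without Gross–Zagier–Kolyvagin
in the kernel (a theorem in print = the held input 19620, not a tree theorem): as typed it is closable only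
after re-typing `PublishedInputRankEqAnalyticRankW → … → rung`. Bookkeeping; nothing booked.
[cite: Kolyvagin1990] [cite: GrossZagier1986] [cite: Miller2011LMS, Def. 1.1] -/
theorem shaFinite_of_intrMod3Rung
    (hrung : ∀ (W : WeierstrassCurve ℚ) [W.IsElliptic] [W.IsGloballyMinimal] [Fact (3 : ℕ).Prime],
      W.analyticRank = 0 → ClassO6 W 3 → ¬ W.HasCM →
      (∀ (W' : WeierstrassCurve ℚ) [W'.IsElliptic] [W'.IsGloballyMinimal], IsIsogenous W W' →
        ∀ q' : ℚ, shaAn W' = (q' : ℂ) → 0 < padicValRat 3 q') →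
      (∃ q : ℚ, shaAn W = (q : ℂ) ∧ 1 ≤ padicValRat 3 q) → 1 ≤ padicValNat 3 W.shaOrder)
    (W : WeierstrassCurve ℚ) [W.IsElliptic] [W.IsGloballyMinimal] [Fact (3 : ℕ).Prime]
    (hr : W.analyticRank = 0) (hO6 : ClassO6 W 3) (hcm : ¬ W.HasCM)
    (hI : ∀ (W' : WeierstrassCurve ℚ) [W'.IsElliptic] [W'.IsGloballyMinimal], IsIsogenous W W' →
      ∀ q' : ℚ, shaAn W' = (q' : ℂ) → 0 < padicValRat 3 q')
    {q : ℚ} (hq : shaAn W = (q : ℂ)) : W.ShaFinite := by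
  have h1 : 1 ≤ padicValRat 3 q := hI W (isIsogenous_self W) q hq
  have hv : 1 ≤ padicValNat 3 W.shaOrder := hrung W hr hO6 hcm hI ⟨q, hq, h1⟩
  have hne : W.shaOrder ≠ 0 := by
    intro h0
    rw [h0, padicValNat_zero_right] at hv
    exact Nat.not_succ_le_zero 0 hv
  exact Nat.finite_of_card_ne_zero hne

end Summit.BirchSwinnertonDyer.BirchSwinnertonDyer.Theorems

end
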